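import Summits.QuantumFields.YangMills.Theorems.BalabanUVNodesN11K1ZBRoadDoorRows
import Summits.QuantumFields.YangMills.Theorems.BalabanUVNodesN11GaussianCertificateDefsChi
import Literature.MathematicalPhysics.QuantumFieldTheory.Balaban1983to89.Node00.N24ItemsStage13AtThm1CCMWZBChiSepCoPH
import Literature.MathematicalPhysics.QuantumFieldTheory.Balaban1983to89.Node00.Record13SepCoPHChi
import Literature.MathematicalPhysics.QuantumFieldTheory.Balaban1983to89.Node00.Record13ResidualsRChi
import Literature.MathematicalPhysics.QuantumFieldTheory.Balaban1983to89.Node00.Record13NumericsOfThm1CCMWZBChi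
import Summits.QuantumFields.YangMills.Theorems.BalabanUVNodesN11HistoryPinnedResidualDefsChi
import Summits.QuantumFields.YangMills.Theorems.BalabanUVNodesN11RePinnedParamDefsChi
import Summits.QuantumFields.YangMills.Theorems.BalabanUVNodesN11NoExpansionAtRecord13CoPChi
import Summits.QuantumFields.YangMills.Theorems.BalabanUVNodesN11NoExpansionDiagonalCoPHChi
import Summits.QuantumFields.YangMills.Theorems.BalabanUVNodesN11BackgroundScaleLocalChi
import Summits.QuantumFields.YangMills.Theorems.BalabanUVNodesN11Sect3SupplyPresentParentsChi
import Summits.QuantumFields.YangMills.Theorems.BalabanUVNodesN11NoExpansionOldFactorsChi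
import Summits.QuantumFields.YangMills.Theorems.BalabanUVNodesN11NoExpansionGeneralStepCoPHOldBranchChi
import Summits.QuantumFields.YangMills.Theorems.BalabanUVNodesN11NoExpansionGeneralStepLawsCoPHChi
import Summits.QuantumFields.YangMills.Theorems.BalabanUVNodesN11NoExpansionGeneralStepGraphChi
import Summits.QuantumFields.YangMills.Theorems.BalabanUVNodesN11DiagonalOldBranchMeasurableChi
import Summits.QuantumFields.YangMills.Theorems.BalabanUVNodesN11OldBranchPairChi
import Summits.QuantumFields.YangMills.Theorems.BalabanUVNodesN11TruncationDominationChi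
import Summits.QuantumFields.YangMills.Theorems.BalabanUVNodesN11Sect3SupplySplicePairChi
import Summits.QuantumFields.YangMills.Theorems.BalabanUVNodesN11Sect3SupplyChainDefsChi
import Summits.QuantumFields.YangMills.Theorems.BalabanUVNodesN11Sect3SupplyChainChi
import Summits.QuantumFields.YangMills.Theorems.BalabanUVNodesN11GaussianCertificateRowsChi
import Summits.QuantumFields.YangMills.Theorems.BalabanUVNodesN11Sect3SupplyChainObligationsPairChi
import Summits.QuantumFields.YangMills.Theorems.BalabanUVNodesN11NodeFacesOfSupplyChainTokensChi
import Literature.MathematicalPhysics.QuantumFieldTheory.Balaban1983to89.Node00.Record13NumericsOfThm1CCMWZBChi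

/-!
# DAG node N11 — χ-GENERIC RE-ISSUE (WORK ORDER RC-1 «RE-CENTRE THE RECORD», director-ym №462 (B) ∕ №467 (D); op 5b N11 slice) of ✓p773221
# `…N11K1ZBRoadDoorRows` §1: THE K1ᴬ ENGINE's FOUR DOOR ROWS at the χ-slot certificate `gaussPinH (ofHistoryBlind ⟨θ₁₅ᶜᶜᴹᵂᶻᴮᵡ(…; χ), Zr⟩) χ` —
# `doorRows_gaussPinH_ofHistoryBlind_theta13OfThm1CCMWZB` in χ (v1: the ONE N11 name the K1ᴬ engine reads, dag-n24-c LOCATED-OP5B I.21577)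

Cell `pub-ymgap` (HUMAN RULING D-0062, Track A), seat `pub-ymgap-dag-n11-d` (g44), helper lane of K1ᴬ = stmt-QuantumFields-27239 (`--kind proof --supports 27239 --as helper`;
count-neutral).  [III] = [Balaban1988Convergent], [V] = [Balaban1989LargeFieldII], [IV] = [Balaban1989LargeFieldI], [I] = [Balaban1987RG1].

WHAT (v1.3 = v1.2 + this paragraph's correction; 3 theorems — v1 the verbatim χ-twin of ✓p773221's first theorem, v1.1 its theorems 2–3, each ONE application; same short names in the sibling namespace
`…N11K1ZBRoadDoorRowsChi`; v1.2 = docstrings only: ref-I READ-993 LOCATED-1 «[V] (0.15) p.360» → (1.15) pp.359–360 (inherited typo; same fix-forward owed in ✓p773221) + NIT 1 stale header): from ANY door proof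
`hP : (ofHistoryBlind ⟨θ₁₅ᶜᶜᴹᵂᶻᴮᵡ, Zr⟩).Provisos₁₃SepCoPHChi F N χ` at node00-def-Y's χ-slot z-witness `θ₁₅ᶜᶜᴹᵂᶻᴮᵡ := theta13OfThm1CCMWZBChi F N j γ εbg ε₀ ε₂₉ B₃ B₃' a₀ a₁ Efl logz χ`
(`Node00/Record13NumericsOfThm1CCMWZBChi`, H3.1 (d)), the four rows at `θᴳᶻᴮᵡ := gaussPinH (ofHistoryBlind ⟨θ₁₅ᶜᶜᴹᵂᶻᴮᵡ, Zr⟩) χ` (this lane's ✓p801064 `…GaussianCertificateDefsChi`):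
`Provisos₁₃SepCoPHChi ∧ Admissible ∧ (ZhUnity ∧ SlotsNondegenerate₁₃Chi) ∧ (∀ P k, k < P.K → TLaw₁₃CoPHChi → SLaw₁₃CoPHChi (k+1))` — by `antecedent_gaussPinH` (χ, ✓p801064) fed with
def-Y's `slotsNondegenerate₁₃_theta13OfThm1CCMWZB_chi` ∕ `admissible_theta13OfThm1CCMWZB_of_le_half_chi` and this lane's χ-twin of dag-n24-c's free-slot row
`N24_laws₁₃CoPH_theta13OfThm1CCMWZB_chi` (`Node00/N24ItemsStage13AtThm1CCMWZBChiSepCoPH`).  At `χ := chiβOfRecord₁₃ _` it is EQUIVALENT to ✓p773221's theorem — NOT definitionally (v1.3, dag-ref-J READ-699 NIT 1 of substance,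
UPHELD): the χ-generic Prop-STRUCTURES re-declared along the chain (`Provisos₁₃SepCoPHChi` [Ax-3d], `…HistoryPinnedResidualDefsChi.IsNoExpHistAt`) are distinct inductive types
bridged by field-wise `Iff` receipts (`provisos₁₃SepCoPHChi_chiβ_iff`; [Ax-3d] §R «defs: rfl; Prop-structures: field-wise Iff»), so the objects built over them — `ZhPinOfRecord₁₃`,
`rePinH`, `gaussPinH` at `chiβOfRecord₁₃` — equal the record's only PROPOSITIONALLY (`propext`∕`funext` through the `dite` guard), and no such receipt is landed (none is needed:
the consumer of this file reads the Ax slot, which has no pre-RC-1 counterpart); the same overstatement sits in the generator header of this lane's other `…Chi` modules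
(e.g. `…GaussianCertificateDefsChi` l.25–26) and is corrected there with their next editions; at
`χ := chiβOfRecord₁₃Ax _` it is the row package the K1ᴬ engine (op 5b) reads.  Theorems 2–3 of ✓p773221 (`supplyChainAt_windowed_…`, `h11Family_…`) are the v1.1 section below (landed ✓p809865 once
`…Sect3SupplyChainObligationsDefsChi` ∕ `…NodeFacesOfSupplyChainTokensChi` had landed).

HONEST FRAMING.  Count-neutral KERNEL COMPOSITION of landed χ-generic theorems; the door proof `hP` is a DISPLAYED HYPOTHESIS; NO value of `εbg`, `E_k`, `log z_k` pinned; the window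
`0 < γ ≤ ½`, the six signs and `0 < εbg` are the only numerics read; nothing of Bałaban asserted; K0ᴬ ∕ K1ᴬ NOT closed; N11 ∕ N13 ∕ N24 NOT discharged; counts unmoved.  One finite
`𝕋⁴_{L^K}` programme at fixed `ε = L^{−K}` — NOT ℝ⁴, NOT OS, NOT a mass gap, NOT Clay.  No `sorry`, `axiom`, `def`, `instance`, `notation`.
Sources (SHAPE ∕ bookkeeping only): [III] Thm 1 p.262, (2.6)–(2.8) pp.255–256, (3.16)–(3.22) pp.268–269, (1.11) p.248, (1.15) p.249, p.244; [I] Thm 1 p.259, (2.9) p.266 (the cut-off's centre);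
[V] Thm 1 p.355 (not exercised), (1.15) pp.359–360; [IV] (0.2)–(0.4) p.176.
-/

noncomputable section

open MeasureTheory
open scoped BigOperators ENNReal NNReal Matrix.Norms.L2Operator

namespace Summit.QuantumFields.YangMills.Theorems.BalabanUVNodesN11K1ZBRoadDoorRowsChi

open Literature.MathematicalPhysics.QuantumFieldTheory.Balaban1983to89 T4Continuum Node00 Node00.Tk DagBinding T4DatumAssembly FlowStepRuns AveragingRT
open BalabanUVNodesN11GaussianCertificateDefsChi (gaussPinH gaussPinH_ζ0 antecedent_gaussPinH)

variable {F : T4Family} {N : ℕ} [NeZero N]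

variable {j : ℕ} {γ εbg ε₀ ε₂₉ B₃ B₃' a₀ a₁ : ℝ} {Efl logz : B12.RunParams → ℕ → ℝ}

/-- **★ THE FOUR DOOR ROWS OF THE K1ᴬ ENGINE AT `θᴳᶻᴮᵡ` FROM ANY DOOR PROOF `hP` AT `θᴴᶻᴮᵡ`, IN THE β-SLOT `χ`** — `Provisos₁₃SepCoPHChi`, `Admissible`,
`ZhUnity ∧ SlotsNondegenerate₁₃Chi` and N13's (R₁₃) law chain `∀ P k, k < P.K → TLaw₁₃CoPHChi → SLaw₁₃CoPHChi (k+1)`, in ONE conjunction (general run-indexed `Zr`; window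
`0 < γ ≤ ½` + the six signs + `0 < εbg`; the letters `Efl ∕ logz ∕ εbg` are NOT read): the verbatim χ-twin of ✓p773221's `doorRows_gaussPinH_ofHistoryBlind_theta13OfThm1CCMWZB`.
CONDITIONAL on `hP`; nothing of Bałaban asserted.
[cite: Balaban1988Convergent, Thm 1 p.262, (2.6)–(2.8) pp.255–256, (3.16)–(3.22) pp.268–269, (1.11) p.248, (1.15) p.249, p.244; Balaban1987RG1, Thm 1 p.259, (2.9) p.266; Balaban1989LargeFieldII, Thm 1 p.355 (not exercised), (1.15) pp.359–360; Balaban1989LargeFieldI, (0.2)–(0.4) p.176 (bookkeeping)] -/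
theorem doorRows_gaussPinH_ofHistoryBlind_theta13OfThm1CCMWZB (χ : ChiSlot F N) (hγ₀ : 0 < γ) (hγh : γ ≤ 1 / 2) (hbg : 0 < εbg) (hε : 0 < ε₀) (hε' : 0 < ε₂₉)
    (hB : 0 ≤ B₃) (hB' : 0 ≤ B₃') (ha₀ : 0 < a₀) (ha₁ : 0 < a₁) (Zr : (q : B12.RunParams) → TkResidualW F N (FluctV N) q.K)
    (hP : (Stage13HParams.ofHistoryBlind F N ⟨theta13OfThm1CCMWZBChi F N j γ εbg ε₀ ε₂₉ B₃ B₃' a₀ a₁ Efl logz χ, Zr⟩).Provisos₁₃SepCoPHChi F N χ) :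
    (gaussPinH (Stage13HParams.ofHistoryBlind F N ⟨theta13OfThm1CCMWZBChi F N j γ εbg ε₀ ε₂₉ B₃ B₃' a₀ a₁ Efl logz χ, Zr⟩) χ).Provisos₁₃SepCoPHChi F N χ ∧
      (gaussPinH (Stage13HParams.ofHistoryBlind F N ⟨theta13OfThm1CCMWZBChi F N j γ εbg ε₀ ε₂₉ B₃ B₃' a₀ a₁ Efl logz χ, Zr⟩) χ).Admissible F N ∧
      ((gaussPinH (Stage13HParams.ofHistoryBlind F N ⟨theta13OfThm1CCMWZBChi F N j γ εbg ε₀ ε₂₉ B₃ B₃' a₀ a₁ Efl logz χ, Zr⟩) χ).ZhUnity F N ∧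
        (gaussPinH (Stage13HParams.ofHistoryBlind F N ⟨theta13OfThm1CCMWZBChi F N j γ εbg ε₀ ε₂₉ B₃ B₃' a₀ a₁ Efl logz χ, Zr⟩) χ).SlotsNondegenerate₁₃Chi F N χ) ∧
      ∀ (P : B12.RunParams) (k : ℕ), k < P.K →
        TLaw₁₃CoPHChi F N (gaussPinH (Stage13HParams.ofHistoryBlind F N ⟨theta13OfThm1CCMWZBChi F N j γ εbg ε₀ ε₂₉ B₃ B₃' a₀ a₁ Efl logz χ, Zr⟩) χ) χ P k →
          SLaw₁₃CoPHChi F N (gaussPinH (Stage13HParams.ofHistoryBlind F N ⟨theta13OfThm1CCMWZBChi F N j γ εbg ε₀ ε₂₉ B₃ B₃' a₀ a₁ Efl logz χ, Zr⟩) χ) χ P (k + 1) := by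
  obtain ⟨hP', hU, hA⟩ := antecedent_gaussPinH hP (slotsNondegenerate₁₃_theta13OfThm1CCMWZB_chi F N j γ εbg ε₀ ε₂₉ B₃ B₃' a₀ a₁ Efl logz χ)
    (admissible_theta13OfThm1CCMWZB_of_le_half_chi F N Efl logz χ hγ₀ hγh hbg hε hε' hB hB' ha₀ ha₁)
  exact ⟨hP', hA, hU, fun P => N24_laws₁₃CoPH_theta13OfThm1CCMWZB_chi χ Zr
    (gaussPinH (Stage13HParams.ofHistoryBlind F N ⟨theta13OfThm1CCMWZBChi F N j γ εbg ε₀ ε₂₉ B₃ B₃' a₀ a₁ Efl logz χ, Zr⟩) χ).Zh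
    (gaussPinH (Stage13HParams.ofHistoryBlind F N ⟨theta13OfThm1CCMWZBChi F N j γ εbg ε₀ ε₂₉ B₃ B₃' a₀ a₁ Efl logz χ, Zr⟩) χ).Phih P hγ₀ hγh hbg hε hε' hB hB' ha₀ ha₁⟩

/-! ## v1.1 (APPEND-ONLY; dag-n11-d g44, N11-σ chain): the remaining cone declarations of this module in χ — every v1 declaration above is byte-identical -/

section V11Append

open B10Eq42TorusConstraint (bondsIn)
open BalabanUVNodesN11Sect3SupplyChainDefs hiding NewEClausesAt NoExpansionClauseFor PresentChildObligations Sect3Supplier baseWitness baseWitness_form chainWitness isFluctLocal_baseWitness isFluctLocal_chainWitness isFluctLocal_spliceTermsB spliceConst spliceConst_of_Omega_empty spliceConst_of_Omega_ne spliceTermsB spliceTermsB_E spliceTermsB_of_Omega_empty spliceTermsB_of_absent spliceTermsB_of_present universalE_spliceTermsB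
open BalabanUVNodesN11Sect3SupplyChainDefsChi
open BalabanUVNodesN11Sect3SupplyChainObligationsDefs hiding ChainFormAt ChainFormTAt NoExpansionObligation OperandRowsAlongChain OperandRowsAt SupplierObligations SupplyChainAt chainFormAt_all_of_obligations chainFormTAt_all_of_obligations chainFormTAt_of_chainFormAt noExpansionObligation_of_gaussCert_of_operandRows tLaw₁₃CoPH_all_of_obligations tLaw₁₃CoPH_of_chainFormTAt thmP245Laws_of_obligations thmP245Laws_of_supplyChainAt
open BalabanUVNodesN11Sect3SupplyChainObligationsDefsChi
open BalabanUVNodesN11GaussianCertificateDefs (provisos₁₃CoPH_gaussPinH gaussPinH_toStage13Params)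
open BalabanUVNodesN11GaussianCertificateDefsChi (gaussPinH gaussPinH_ζ0 gaussPinH_quad antecedent_gaussPinH)
open BalabanUVNodesN11GaussianCertificateRowsChi (zhUnity_of_gaussCert)
open BalabanUVNodesN11NodeFacesOfSupplyChainTokensChi (h11Family_of_supplyChainAt_family)

section
variable {F : T4Family} {N : ℕ} [NeZero N]
variable {j : ℕ} {γ εbg ε₀ ε₂₉ B₃ B₃' a₀ a₁ : ℝ} {Efl logz : B12.RunParams → ℕ → ℝ}

/-- **★ THE SUPPLY CHAIN AT `θᴳᶻᴮ` ON EVERY WINDOWED RUN FROM THE K1 FACE's `h11N` TOKEN** — from `∃ σ, (windowed SupplierObligations) ∧ (windowed OperandRowsAlongChain)`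
(dag-n24-c's face binder, verbatim shape) and any door proof `hG` at `θᴳᶻᴮ`: `∀ P, Step.InInterval γ′ P.K (gOfRecord₁₃ θ₁₅ᶜᶜᴹᵂᶻᴮ P) → SupplyChainAt θᴳᶻᴮ P` — the
no-expansion obligation discharged at the Gaussian-class certificate by `noExpansionObligation_of_gaussCert_of_operandRows` (`gaussPinH_ζ0 ∕ _quad`, `M = L^j ≥ 1`).
CONDITIONAL; nothing of Bałaban asserted. [cite: Balaban1988Convergent, §3 p.279, (3.16)–(3.25) pp.268–270, (2.21) p.258, Thm 1 p.262 (bookkeeping)] -/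
theorem supplyChainAt_windowed_gaussPinH_ofHistoryBlind_theta13OfThm1CCMWZB_of_exists_supplier (χ : ChiSlot F N)
    (Zr : (q : B12.RunParams) → TkResidualW F N (FluctV N) q.K)
    (hG : (gaussPinH (Stage13HParams.ofHistoryBlind F N ⟨theta13OfThm1CCMWZBChi F N j γ εbg ε₀ ε₂₉ B₃ B₃' a₀ a₁ Efl logz χ, Zr⟩) χ).Provisos₁₃SepCoPHChi F N χ) {γ' : ℝ}
    (hN11 : ∃ σ : (P : B12.RunParams) → Sect3Supplier (gaussPinH (Stage13HParams.ofHistoryBlind F N ⟨theta13OfThm1CCMWZBChi F N j γ εbg ε₀ ε₂₉ B₃ B₃' a₀ a₁ Efl logz χ, Zr⟩) χ) χ P,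
      (∀ P : B12.RunParams, Step.InInterval γ' P.K (gOfRecord₁₃Chi F N (theta13OfThm1CCMWZBChi F N j γ εbg ε₀ ε₂₉ B₃ B₃' a₀ a₁ Efl logz χ) χ P) →
        SupplierObligations (gaussPinH (Stage13HParams.ofHistoryBlind F N ⟨theta13OfThm1CCMWZBChi F N j γ εbg ε₀ ε₂₉ B₃ B₃' a₀ a₁ Efl logz χ, Zr⟩) χ) χ P (σ P)) ∧
      (∀ P : B12.RunParams, Step.InInterval γ' P.K (gOfRecord₁₃Chi F N (theta13OfThm1CCMWZBChi F N j γ εbg ε₀ ε₂₉ B₃ B₃' a₀ a₁ Efl logz χ) χ P) →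
        OperandRowsAlongChain (gaussPinH (Stage13HParams.ofHistoryBlind F N ⟨theta13OfThm1CCMWZBChi F N j γ εbg ε₀ ε₂₉ B₃ B₃' a₀ a₁ Efl logz χ, Zr⟩) χ) χ P (σ P))) :
    ∀ P : B12.RunParams, Step.InInterval γ' P.K (gOfRecord₁₃Chi F N (theta13OfThm1CCMWZBChi F N j γ εbg ε₀ ε₂₉ B₃ B₃' a₀ a₁ Efl logz χ) χ P) →
      SupplyChainAt (gaussPinH (Stage13HParams.ofHistoryBlind F N ⟨theta13OfThm1CCMWZBChi F N j γ εbg ε₀ ε₂₉ B₃ B₃' a₀ a₁ Efl logz χ, Zr⟩) χ) χ P := by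
  obtain ⟨σ, hσ, hops⟩ := hN11
  intro P hw
  exact ⟨σ P, hσ P hw, noExpansionObligation_of_gaussCert_of_operandRows
    (gaussPinH_ζ0 _ χ) (gaussPinH_quad _ χ) hG.toCore (by show 1 ≤ F.L ^ j; exact Nat.one_le_pow _ _ (by have := F.hL11; omega)) (σ P) (hσ P hw).loc (hops P hw)⟩

end

section
variable {F : T4Family} {N : ℕ} [NeZero N]
variable {j : ℕ} {γ εbg ε₀ ε₂₉ B₃ B₃' a₀ a₁ : ℝ} {Efl logz : B12.RunParams → ℕ → ℝ}

/-- **★★★ N11's CHILD FAMILY IN dag-n24-c's `h11` SHAPE AT `θᴳᶻᴮ`'s SepCoPH DATUM FROM THE FACE's `h11N` TOKEN** — `∃ σ, (windowed SupplierObligations) ∧ (windowed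
OperandRowsAlongChain)` on the step window `]0, γ′]`, `0 < γ′`, any door proof `hG` (keys the datum); `γ₁₁ := γ′`; window `0 < γ ≤ ½` + six signs + `0 < εbg`; the letters
`Efl ∕ logz ∕ εbg` are NOT read; of the node's leaf antecedents only `smallCouplings` is read.  Proof: the ROAD-AGNOSTIC socket `h11Family_of_supplyChainAt_family` at `θᴳᶻᴮ`
(live-selector line by `rfl`; admissibility ∕ `0 ≤ κ, E₀, B₀` ∕ `1 ≤ M` from Z3's `admissible_theta13OfThm1CCMWZB_of_le_half_chi` and the family's numerals `κ = 2·10⁴`,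
`E₀ = B₀ = 1`, `M = L^j`) fed by the previous theorem.  CONDITIONAL on `hG` and `h11N` ([III] §3's supplier = Thm 2 proper, nobody's theorem); nothing of Bałaban asserted;
N11 NOT discharged; K1⁹ NOT closed. [cite: Balaban1988Convergent, Theorem p.245, Thm 1 p.262, remark p.262, p.244 L36–38, §3 p.279, (3.16)–(3.25) pp.268–270, (2.21) p.258, (1.15) p.249; Balaban1989LargeFieldII, Thm 1 + (0.1) pp.355–356, (1.15) pp.359–360; Balaban1987RG1, Thm 1 p.259; Balaban1989LargeFieldI, (0.3)–(0.4) p.176, p.177 (i)–(ii)] -/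
theorem h11Family_gaussPinH_ofHistoryBlind_theta13OfThm1CCMWZB_of_exists_supplier_windowed (χ : ChiSlot F N) (hγ₀ : 0 < γ) (hγh : γ ≤ 1 / 2) (hbg : 0 < εbg)
    (hε : 0 < ε₀) (hε' : 0 < ε₂₉) (hB : 0 ≤ B₃) (hB' : 0 ≤ B₃') (ha₀ : 0 < a₀) (ha₁ : 0 < a₁)
    (Zr : (q : B12.RunParams) → TkResidualW F N (FluctV N) q.K)
    (hG : (gaussPinH (Stage13HParams.ofHistoryBlind F N ⟨theta13OfThm1CCMWZBChi F N j γ εbg ε₀ ε₂₉ B₃ B₃' a₀ a₁ Efl logz χ, Zr⟩) χ).Provisos₁₃SepCoPHChi F N χ) {γ' : ℝ} (hγ' : 0 < γ')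
    (hN11 : ∃ σ : (P : B12.RunParams) → Sect3Supplier (gaussPinH (Stage13HParams.ofHistoryBlind F N ⟨theta13OfThm1CCMWZBChi F N j γ εbg ε₀ ε₂₉ B₃ B₃' a₀ a₁ Efl logz χ, Zr⟩) χ) χ P,
      (∀ P : B12.RunParams, Step.InInterval γ' P.K (gOfRecord₁₃Chi F N (theta13OfThm1CCMWZBChi F N j γ εbg ε₀ ε₂₉ B₃ B₃' a₀ a₁ Efl logz χ) χ P) →
        SupplierObligations (gaussPinH (Stage13HParams.ofHistoryBlind F N ⟨theta13OfThm1CCMWZBChi F N j γ εbg ε₀ ε₂₉ B₃ B₃' a₀ a₁ Efl logz χ, Zr⟩) χ) χ P (σ P)) ∧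
      (∀ P : B12.RunParams, Step.InInterval γ' P.K (gOfRecord₁₃Chi F N (theta13OfThm1CCMWZBChi F N j γ εbg ε₀ ε₂₉ B₃ B₃' a₀ a₁ Efl logz χ) χ P) →
        OperandRowsAlongChain (gaussPinH (Stage13HParams.ofHistoryBlind F N ⟨theta13OfThm1CCMWZBChi F N j γ εbg ε₀ ε₂₉ B₃ B₃' a₀ a₁ Efl logz χ, Zr⟩) χ) χ P (σ P))) :
    ∀ βup β₀ : ℝ, ∃ γ₁₁ : ℝ, 0 < γ₁₁ ∧ ∀ w : WorldP,
      w.C = (datumOfRecord₁₃SepCoPHChi F N (gaussPinH (Stage13HParams.ofHistoryBlind F N ⟨theta13OfThm1CCMWZBChi F N j γ εbg ε₀ ε₂₉ B₃ B₃' a₀ a₁ Efl logz χ, Zr⟩) χ) χ hG).C →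
      w.βup = βup → w.β₀ = β₀ → w.γ ≤ γ₁₁ → ∀ P : B12.RunParams, (leavesP w P).b7 → (leavesP w P).b8 → (leavesP w P).b9 → (leavesP w P).b10 → (leavesP w P).b11 →
      (leavesP w P).smallCouplings → (leavesP w P).smallFieldInductive → (leavesP w P).flowControl →
        ∀ k, k < P.K → SLaw₁₃CoPHChi F N (gaussPinH (Stage13HParams.ofHistoryBlind F N ⟨theta13OfThm1CCMWZBChi F N j γ εbg ε₀ ε₂₉ B₃ B₃' a₀ a₁ Efl logz χ, Zr⟩) χ) χ P k →
          TLaw₁₃CoPHChi F N (gaussPinH (Stage13HParams.ofHistoryBlind F N ⟨theta13OfThm1CCMWZBChi F N j γ εbg ε₀ ε₂₉ B₃ B₃' a₀ a₁ Efl logz χ, Zr⟩) χ) χ P k :=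
  h11Family_of_supplyChainAt_family _ χ hG rfl
    (admissible_theta13OfThm1CCMWZB_of_le_half_chi F N Efl logz χ hγ₀ hγh hbg hε hε' hB hB' ha₀ ha₁)
    (by change (0 : ℝ) ≤ (stage12NumericsOfThm1CCMWB F.L j γ εbg ε₀ B₃ B₃' a₀ a₁).s2.lf.κ
        rw [show (stage12NumericsOfThm1CCMWB F.L j γ εbg ε₀ B₃ B₃' a₀ a₁).s2.lf.κ = 20000 from rfl]; norm_num)
    (by change (0 : ℝ) ≤ (stage12NumericsOfThm1CCMWB F.L j γ εbg ε₀ B₃ B₃' a₀ a₁).s2.lf.E₀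
        rw [show (stage12NumericsOfThm1CCMWB F.L j γ εbg ε₀ B₃ B₃' a₀ a₁).s2.lf.E₀ = 1 from rfl]; norm_num)
    (by change (0 : ℝ) ≤ (stage12NumericsOfThm1CCMWB F.L j γ εbg ε₀ B₃ B₃' a₀ a₁).s2.lf.B₀
        rw [show (stage12NumericsOfThm1CCMWB F.L j γ εbg ε₀ B₃ B₃' a₀ a₁).s2.lf.B₀ = 1 from rfl]; norm_num)
    (by show 1 ≤ F.L ^ j; exact Nat.one_le_pow _ _ (by have := F.hL11; omega)) hγ'
    (supplyChainAt_windowed_gaussPinH_ofHistoryBlind_theta13OfThm1CCMWZB_of_exists_supplier χ Zr hG hN11)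

end

end V11Append

end Summit.QuantumFields.YangMills.Theorems.BalabanUVNodesN11K1ZBRoadDoorRowsChi

end
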